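import Literature.NumberTheory.BeurlingPrimes.HilberdinkMellin
import Mathlib.Analysis.Complex.LocallyUniformLimit
import Mathlib.Analysis.SpecialFunctions.Complex.LogBounds
import Mathlib.Analysis.SpecialFunctions.Pow.Deriv
import HarnessLib

/-!
# Hilberdink's uncertainty principle, III: `−ζ_P'/ζ_P = s∫₁^∞ ψ_P x^{−s−1}` and its continuation `F̃`

Topic `Literature/NumberTheory/BeurlingPrimes`, grouping namespace `Hilberdink`. Everything in this
file is PROVED. Hilberdink–Lapidus 2006, §2.1: with `φ(s) = −ζ'(s)/ζ(s) = ∑_{n ∈ 𝒩} Λ(n) n^{−s}`,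
"`φ(s) = s∫₁^∞ ψ(x) x^{−s−1} dx`", and (proof of Theorem 2.1) "by hypothesis `ψ(x) = x + r(x)` …
`φ(s) = s/(s−1) + s∫₁^∞ r(x)x^{−s−1} dx`. The latter integral converges for `Re s > α` and represents
an analytic function in this half-plane."

* `Hilberdink.vonMangoldtSeries P s = ∑_{(j,m)} log λ_j · λ_j^{−(m+1)s}` (the Dirichlet series of
  `φ = −ζ_P'/ζ_P`), `= s ∫₁^∞ ψ_P(x) x^{−s−1} dx` for `Re s > 1` (`vonMangoldtSeries_eq_mul_integral`);
* `Hilberdink.errPsi P = 1_{(1,∞)}(ψ_P − x)`; under `|ψ_P(x) − x| ≤ Cx^θ` its Mellin transform is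
  holomorphic on `Re s > θ` with `‖·‖ ≤ C/(Re s − θ)`, and
  `s · mellin (errPsi P) (−s) = vonMangoldtSeries P s − s/(s−1)` on `Re s > 1`;
  `Hilberdink.Ftilde P s = s + s(s−1)·mellin (errPsi P)(−s)` continues `(s−1)φ(s)`;
* the Euler logarithm `Hilberdink.eulerLog P s = ∑_j log((1 − λ_j^{−s})⁻¹)` (tree:
  `ζ_P = exp ∘ eulerLog`, `zeta_eq_exp_tsum`) is holomorphic on `Re s > 1`, bounded on `Re s ≥ σ₀ > 1`,
  and `deriv eulerLog s = −vonMangoldtSeries s` (`hasDerivAt_eulerLog`, termwise differentiation,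
  Mathlib `Complex.hasSum_deriv_of_summable_norm`).

## References
* T. W. Hilberdink, M. L. Lapidus, *Beurling zeta functions, generalised primes, and fractal
  membranes*, Acta Appl. Math. 94 (2006), arXiv:math/0410270, §2.1, Theorem 2.1 (first half).
* [Hilberdink2005] T. W. Hilberdink, *Well-behaved Beurling primes and integers*, J. Number Theory
  112 (2005) 332–344, §1.
-/

noncomputable section

open Set Filter MeasureTheory Complex Asymptotics
open scoped Topology

namespace Literature.NumberTheory.BeurlingPrimes

open Literature.Barriers.RiemannHypothesis

namespace Hilberdink

variable (P : BeurlingPrimes)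

/-! ### The Dirichlet series of `−ζ_P'/ζ_P` -/

/-- `φ(s) = ∑_{(j,m)} log λ_j · (λ_j^{m+1})^{−s}`, the Dirichlet series `∑_{n} Λ_P(n) n^{−s}` of
`−ζ_P'/ζ_P` (Hilberdink–Lapidus 2006, §2.1). [cite: Hilberdink2005, §1] -/
def vonMangoldtSeries (s : ℂ) : ℂ :=
  ∑' jm : ℕ × ℕ, (Real.log (P.prime jm.1) : ℂ) * ((P.prime jm.1 ^ (jm.2 + 1) : ℝ) : ℂ) ^ (-s)

/-- The norm of the `(j,m)` term on `Re s = σ`: `log λ_j · λ_j^{−(m+1)σ}`. [folklore] -/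
theorem norm_vonMangoldt_term (s : ℂ) (jm : ℕ × ℕ) :
    ‖(Real.log (P.prime jm.1) : ℂ) * ((P.prime jm.1 ^ (jm.2 + 1) : ℝ) : ℂ) ^ (-s)‖ =
      Real.log (P.prime jm.1) * P.prime jm.1 ^ (-((jm.2 + 1 : ℕ) * s.re)) := by
  have hp : 0 < P.prime jm.1 ^ (jm.2 + 1) := pow_pos (P.prime_pos _) _
  have he : ((jm.2 + 1 : ℕ) : ℝ) * -s.re = -((jm.2 + 1 : ℕ) * s.re) := by ring
  rw [norm_mul, Complex.norm_real, Real.norm_eq_abs, abs_of_pos (Real.log_pos (P.one_lt_prime _)),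
    norm_cpow_eq_rpow_re_of_pos hp, neg_re, ← Real.rpow_natCast,
    ← Real.rpow_mul (P.prime_pos _).le, he]

/-- The von Mangoldt series converges absolutely for `Re s > 1` (when `N_P(x) ≤ Bx`). [folklore] -/
theorem summable_norm_vonMangoldt_term {B : ℝ} (hB : ∀ x : ℝ, 1 ≤ x → (P.intCount x : ℝ) ≤ B * x)
    {s : ℂ} (hs : 1 < s.re) :
    Summable fun jm : ℕ × ℕ ↦ ‖(Real.log (P.prime jm.1) : ℂ) * ((P.prime jm.1 ^ (jm.2 + 1) : ℝ) : ℂ) ^ (-s)‖ := by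
  simp_rw [norm_vonMangoldt_term]
  exact summable_primePow_rpow P hB hs

/-- **`φ(s) = s ∫₁^∞ ψ_P(x) x^{−s−1} dx` for `Re s > 1`.** [cite: Hilberdink2005, §1] -/
theorem vonMangoldtSeries_eq_mul_integral {B : ℝ} (hB : ∀ x : ℝ, 1 ≤ x → (P.intCount x : ℝ) ≤ B * x)
    {s : ℂ} (hs : 1 < s.re) :
    vonMangoldtSeries P s = s * ∫ x in Ioi (1 : ℝ), (P.chebyshevPsi x : ℂ) * (x : ℂ) ^ (-s - 1) := by
  have hs0 : 0 < s.re := by linarith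
  have hsum : Summable fun jm : ℕ × ℕ ↦ ‖(Real.log (P.prime jm.1) : ℂ)‖ * (P.prime jm.1 ^ (jm.2 + 1)) ^ (-s.re) := by
    refine (summable_primePow_rpow P hB hs).congr fun jm ↦ ?_
    have he : ((jm.2 + 1 : ℕ) : ℝ) * -s.re = -((jm.2 + 1 : ℕ) * s.re) := by ring
    rw [Complex.norm_real, Real.norm_eq_abs, abs_of_pos (Real.log_pos (P.one_lt_prime _)),
      ← Real.rpow_natCast, ← Real.rpow_mul (P.prime_pos _).le, he]
  have hA : ∀ x : ℝ, HasSum (fun jm : ℕ × ℕ ↦ if P.prime jm.1 ^ (jm.2 + 1) ≤ x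
      then (Real.log (P.prime jm.1) : ℂ) else 0) (P.chebyshevPsi x : ℂ) := by
    intro x
    have h := Complex.hasSum_ofReal.mpr (P.summable_psiTerm x).hasSum
    rw [← P.chebyshevPsi_eq_tsum] at h
    have hfun : (fun jm : ℕ × ℕ ↦ if P.prime jm.1 ^ (jm.2 + 1) ≤ x then (Real.log (P.prime jm.1) : ℂ) else 0)
        = fun jm ↦ (P.psiTerm x jm : ℂ) := by
      funext jm
      unfold BeurlingPrimes.psiTerm
      split_ifs <;> simp
    rw [hfun]
    exact h
  have h := mul_setIntegral_counting_eq_tsum (v := fun jm : ℕ × ℕ ↦ P.prime jm.1 ^ (jm.2 + 1))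
    (w := fun jm : ℕ × ℕ ↦ (Real.log (P.prime jm.1) : ℂ))
    (fun jm ↦ one_le_pow₀ (P.one_lt_prime jm.1).le) hs0 hsum hA
  rw [h]
  rfl

/-! ### The error term `R = ψ_P − x` and the continuation `F̃` of `(s−1)φ(s)` -/

/-- `R(x) = 1_{(1,∞)}(x) (ψ_P(x) − x)`, complex-valued. [cite: Hilberdink2005, §2.1 (2.1)] -/
def errPsi : ℝ → ℂ := (Ioi 1).indicator fun x ↦ ((P.chebyshevPsi x - x : ℝ) : ℂ)

variable {P}

/-- `R(x) = ψ_P(x) − x` for `x > 1`. [folklore] -/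
theorem errPsi_of_one_lt {x : ℝ} (hx : 1 < x) : errPsi P x = ((P.chebyshevPsi x - x : ℝ) : ℂ) :=
  indicator_of_mem (mem_Ioi.mpr hx) _

/-- `R(x) = 0` for `x ≤ 1`. [folklore] -/
theorem errPsi_of_le_one {x : ℝ} (hx : x ≤ 1) : errPsi P x = 0 :=
  indicator_of_notMem (by simpa using hx) _

variable (P) in
/-- `R` is measurable. [folklore] -/
theorem measurable_errPsi : Measurable (errPsi P) := by
  refine (Continuous.measurable continuous_ofReal).comp ?_ |>.indicator measurableSet_Ioi
  exact (measurable_chebyshevPsi P).sub measurable_id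

variable (P) in
/-- `R` is integrable on `(0, X]`. [folklore] -/
theorem integrableOn_errPsi (X : ℝ) : IntegrableOn (errPsi P) (Ioc 0 X) := by
  unfold errPsi
  rw [integrableOn_indicator_iff measurableSet_Ioi]
  refine IntegrableOn.mono_set ?_ (show Ioi 1 ∩ Ioc 0 X ⊆ Ioc 1 X from fun x hx ↦ ⟨hx.1, hx.2.2⟩)
  refine Integrable.mono' (g := fun _ ↦ P.chebyshevPsi X + |X|) (integrableOn_const (by simp)) ?_ ?_
  · exact (continuous_ofReal.measurable.comp
      ((measurable_chebyshevPsi P).sub measurable_id)).aestronglyMeasurable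
  · rw [ae_restrict_iff' measurableSet_Ioc]
    refine Eventually.of_forall fun x hx ↦ ?_
    rw [Complex.norm_real, Real.norm_eq_abs]
    have h1 : 0 ≤ P.chebyshevPsi x := P.chebyshevPsi_nonneg x
    have h2 : P.chebyshevPsi x ≤ P.chebyshevPsi X := P.chebyshevPsi_mono hx.2
    have h3 : |x| ≤ |X| := abs_le_abs hx.2 (by linarith [hx.1, hx.2])
    calc |P.chebyshevPsi x - x| ≤ |P.chebyshevPsi x| + |x| := abs_sub _ _
      _ ≤ P.chebyshevPsi X + |X| := by rw [abs_of_nonneg h1]; linarith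

variable (P) in
/-- `R` is locally integrable on `(0, ∞)`. [folklore] -/
theorem locallyIntegrableOn_errPsi : LocallyIntegrableOn (errPsi P) (Ioi 0) := by
  rw [locallyIntegrableOn_iff isOpen_Ioi.isLocallyClosed]
  intro k hk hkc
  obtain ⟨X, hX⟩ := hkc.isBounded.bddAbove
  exact (integrableOn_errPsi P X).mono_set fun v hv ↦ ⟨hk hv, hX hv⟩

variable (P) in
/-- `R = 0` near `0⁺`. [folklore] -/
theorem errPsi_isBigO_zero (b : ℝ) : errPsi P =O[𝓝[>] 0] fun x : ℝ ↦ x ^ (-b) := by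
  have h : errPsi P =ᶠ[𝓝[>] 0] fun _ ↦ (0 : ℂ) := by
    have : Ioo (0 : ℝ) 1 ∈ 𝓝[>] (0 : ℝ) := Ioo_mem_nhdsGT one_pos
    filter_upwards [this] with x hx
    rw [errPsi_of_le_one hx.2.le]
  exact (isBigO_zero _ _).congr' h.symm EventuallyEq.rfl

variable (P) in
/-- `mellin (errPsi P) (−s) = ∫₁^∞ (ψ_P(x) − x) x^{−s−1} dx`. [folklore] -/
theorem mellin_errPsi_eq_setIntegral (s : ℂ) :
    mellin (errPsi P) (-s) = ∫ x in Ioi (1 : ℝ), ((P.chebyshevPsi x - x : ℝ) : ℂ) * (x : ℂ) ^ (-s - 1) := by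
  rw [errPsi, mellin_indicator_Ioi_one]

/-- From `|f(x)| ≤ C x^θ` on `[1, ∞)`: `0 ≤ C` (take `x = 1`). [folklore] -/
theorem nonneg_of_abs_le_mul_rpow {f : ℝ → ℝ} {C θ : ℝ} (h : ∀ x : ℝ, 1 ≤ x → |f x| ≤ C * x ^ θ) :
    0 ≤ C := by
  have := (abs_nonneg _).trans (h 1 le_rfl)
  simpa using this

section bounds

variable {C θ : ℝ} (hψ : ∀ x : ℝ, 1 ≤ x → |P.chebyshevPsi x - x| ≤ C * x ^ θ)
include hψ

/-- `‖R(x)‖ ≤ C x^θ` for `x > 0`. [folklore] -/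
theorem norm_errPsi_le {x : ℝ} (hx : 0 < x) : ‖errPsi P x‖ ≤ C * x ^ θ := by
  rcases le_or_gt x 1 with h | h
  · rw [errPsi_of_le_one h, norm_zero]
    exact mul_nonneg (nonneg_of_abs_le_mul_rpow hψ) (Real.rpow_nonneg hx.le _)
  · rw [errPsi_of_one_lt h, Complex.norm_real, Real.norm_eq_abs]
    exact hψ x h.le

/-- `R = O(x^θ)` at `∞`. [folklore] -/
theorem errPsi_isBigO_top : errPsi P =O[atTop] fun x : ℝ ↦ x ^ (-(-θ)) := by
  refine IsBigO.of_bound C ?_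
  filter_upwards [eventually_gt_atTop (0 : ℝ)] with x hx
  rw [neg_neg, Real.norm_eq_abs, abs_of_nonneg (Real.rpow_nonneg hx.le _)]
  exact norm_errPsi_le hψ hx

/-- **`s ↦ ∫₁^∞ R(x) x^{−s−1} dx` is holomorphic on `Re s > θ`.** [cite: Hilberdink2005, §1] -/
theorem differentiableAt_mellin_errPsi {s : ℂ} (hs : θ < s.re) :
    DifferentiableAt ℂ (fun s ↦ mellin (errPsi P) (-s)) s := by
  have h : DifferentiableAt ℂ (mellin (errPsi P)) (-s) :=
    mellin_differentiableAt_of_isBigO_rpow (locallyIntegrableOn_errPsi P) (errPsi_isBigO_top hψ)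
      (by rw [neg_re]; linarith) (errPsi_isBigO_zero P ((-s).re - 1)) (by linarith)
  exact h.comp s differentiableAt_id.neg

/-- Holomorphy on the half-plane `Re s > θ`. [cite: Hilberdink2005, §1] -/
theorem differentiableOn_mellin_errPsi :
    DifferentiableOn ℂ (fun s ↦ mellin (errPsi P) (-s)) {s : ℂ | θ < s.re} :=
  fun _ hs ↦ (differentiableAt_mellin_errPsi hψ hs).differentiableWithinAt

/-- **`‖∫₁^∞ R(x) x^{−s−1} dx‖ ≤ C/(Re s − θ)`** for `Re s > θ`. [cite: Hilberdink2005, §1] -/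
theorem norm_mellin_errPsi_le {s : ℂ} (hs : θ < s.re) : ‖mellin (errPsi P) (-s)‖ ≤ C / (s.re - θ) := by
  rw [mellin_errPsi_eq_setIntegral]
  have hexp : θ - s.re - 1 < -1 := by linarith
  have hint : IntegrableOn (fun x : ℝ ↦ C * x ^ (θ - s.re - 1)) (Ioi 1) :=
    (integrableOn_Ioi_rpow_of_lt hexp zero_lt_one).const_mul C
  have hbound : ∀ᵐ x ∂(volume.restrict (Ioi (1 : ℝ))),
      ‖((P.chebyshevPsi x - x : ℝ) : ℂ) * (x : ℂ) ^ (-s - 1)‖ ≤ C * x ^ (θ - s.re - 1) := by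
    rw [ae_restrict_iff' measurableSet_Ioi]
    refine Eventually.of_forall fun x hx ↦ ?_
    have hx0 : 0 < x := zero_lt_one.trans hx
    rw [norm_mul, norm_cpow_eq_rpow_re_of_pos hx0, ← errPsi_of_one_lt hx]
    have hre : (-s - 1).re = -s.re - 1 := by simp
    rw [hre]
    calc ‖errPsi P x‖ * x ^ (-s.re - 1) ≤ C * x ^ θ * x ^ (-s.re - 1) :=
          mul_le_mul_of_nonneg_right (norm_errPsi_le hψ hx0) (Real.rpow_nonneg hx0.le _)
      _ = C * x ^ (θ - s.re - 1) := by rw [mul_assoc, ← Real.rpow_add hx0]; ring_nf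
  refine (norm_integral_le_of_norm_le hint hbound).trans (le_of_eq ?_)
  rw [integral_const_mul, integral_Ioi_rpow_of_lt hexp zero_lt_one, Real.one_rpow]
  have : θ - s.re - 1 + 1 = -(s.re - θ) := by ring
  rw [this, neg_div_neg_eq, ← div_eq_mul_one_div]

end bounds

/-- `x ↦ ψ_P(x) x^{−s−1}` is integrable on `(1, ∞)` for `Re s > 1`, when `|ψ_P(x) − x| ≤ Cx^θ` with
`θ ≤ 1` (so `ψ_P(x) ≤ (1 + C)x`). [folklore] -/
theorem integrableOn_chebyshevPsi_mul_cpow {C θ : ℝ} (hθ : θ ≤ 1)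
    (hψ : ∀ x : ℝ, 1 ≤ x → |P.chebyshevPsi x - x| ≤ C * x ^ θ) {s : ℂ} (hs : 1 < s.re) :
    IntegrableOn (fun x : ℝ ↦ (P.chebyshevPsi x : ℂ) * (x : ℂ) ^ (-s - 1)) (Ioi 1) := by
  have hmeas : AEStronglyMeasurable (fun x : ℝ ↦ (P.chebyshevPsi x : ℂ) * (x : ℂ) ^ (-s - 1))
      (volume.restrict (Ioi 1)) :=
    ((Complex.measurable_ofReal.comp (measurable_chebyshevPsi P)).mul
      (Complex.measurable_ofReal.pow_const _)).aestronglyMeasurable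
  refine Integrable.mono' ((integrableOn_Ioi_rpow_of_lt (show -s.re < -1 by linarith) zero_lt_one).const_mul (1 + C))
    hmeas ?_
  rw [ae_restrict_iff' measurableSet_Ioi]
  refine Eventually.of_forall fun x hx ↦ ?_
  have hx0 : 0 < x := zero_lt_one.trans hx
  have hxθ : x ^ θ ≤ x := by
    calc x ^ θ ≤ x ^ (1 : ℝ) := Real.rpow_le_rpow_of_exponent_le hx.le hθ
      _ = x := Real.rpow_one x
  have hψx : P.chebyshevPsi x ≤ (1 + C) * x := by
    have := (abs_le.mp (hψ x hx.le)).2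
    have hC := nonneg_of_abs_le_mul_rpow hψ
    nlinarith
  rw [norm_mul, norm_cpow_eq_rpow_re_of_pos hx0, show (-s - 1).re = -s.re - 1 by simp,
    Complex.norm_real, Real.norm_eq_abs, abs_of_nonneg (P.chebyshevPsi_nonneg x)]
  calc P.chebyshevPsi x * x ^ (-s.re - 1) ≤ (1 + C) * x * x ^ (-s.re - 1) :=
        mul_le_mul_of_nonneg_right hψx (Real.rpow_nonneg hx0.le _)
    _ = (1 + C) * (x ^ (1 : ℝ) * x ^ (-s.re - 1)) := by rw [Real.rpow_one]; ring
    _ = (1 + C) * x ^ (-s.re) := by rw [← Real.rpow_add hx0]; ring_nf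

/-- Under `|ψ_P(x) − x| ≤ Cx^θ` (`θ ≤ 1`) we have `N_P(x) ≤ Bx`-type control only for `ψ`; the
counting bound needed for convergence is supplied separately. **`s · ∫₁^∞ R(x) x^{−s−1} dx =
φ(s) − s/(s−1)` for `Re s > 1`.** [cite: Hilberdink2005, §1] -/
theorem mul_mellin_errPsi_eq {B C θ : ℝ} (hB : ∀ x : ℝ, 1 ≤ x → (P.intCount x : ℝ) ≤ B * x) (hθ : θ ≤ 1)
    (hψ : ∀ x : ℝ, 1 ≤ x → |P.chebyshevPsi x - x| ≤ C * x ^ θ) {s : ℂ} (hs : 1 < s.re) :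
    s * mellin (errPsi P) (-s) = vonMangoldtSeries P s - s / (s - 1) := by
  rw [mellin_errPsi_eq_setIntegral, vonMangoldtSeries_eq_mul_integral P hB hs]
  have h1 := integrableOn_chebyshevPsi_mul_cpow hθ hψ hs
  have h2 : IntegrableOn (fun x : ℝ ↦ (x : ℂ) * (x : ℂ) ^ (-s - 1)) (Ioi 1) := by
    have h : ∀ x ∈ Ioi (1 : ℝ), (x : ℂ) ^ (-s) = (x : ℂ) * (x : ℂ) ^ (-s - 1) := by
      intro x hx
      have hx0 : (x : ℂ) ≠ 0 := ofReal_ne_zero.mpr (zero_lt_one.trans hx).ne'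
      symm
      calc (x : ℂ) * (x : ℂ) ^ (-s - 1) = (x : ℂ) ^ (1 : ℂ) * (x : ℂ) ^ (-s - 1) := by rw [cpow_one]
        _ = (x : ℂ) ^ ((1 : ℂ) + (-s - 1)) := (cpow_add _ _ hx0).symm
        _ = (x : ℂ) ^ (-s) := by ring_nf
    exact (integrableOn_Ioi_cpow_of_lt (by simp; linarith) zero_lt_one).congr_fun h measurableSet_Ioi
  have hsplit : ∀ x : ℝ, ((P.chebyshevPsi x - x : ℝ) : ℂ) * (x : ℂ) ^ (-s - 1) =
      (P.chebyshevPsi x : ℂ) * (x : ℂ) ^ (-s - 1) - (x : ℂ) * (x : ℂ) ^ (-s - 1) := by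
    intro x; push_cast; ring
  simp_rw [hsplit]
  rw [integral_sub h1 h2, setIntegral_mul_cpow_eq hs]
  have hs1 : s - 1 ≠ 0 := by
    intro h0; have := congrArg Complex.re h0; simp at this; linarith
  field_simp

/-- **`F̃(s) = s + s(s−1) ∫₁^∞ R(x) x^{−s−1} dx`**, the continuation of `(s − 1)φ(s)` to `Re s > θ`.
[cite: Hilberdink2005, §1] -/
def Ftilde (P : BeurlingPrimes) (s : ℂ) : ℂ := s + s * (s - 1) * mellin (errPsi P) (-s)

/-- `F̃` is holomorphic on `Re s > θ`. [cite: Hilberdink2005, §1] -/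
theorem differentiableOn_Ftilde {C θ : ℝ} (hψ : ∀ x : ℝ, 1 ≤ x → |P.chebyshevPsi x - x| ≤ C * x ^ θ) :
    DifferentiableOn ℂ (Ftilde P) {s : ℂ | θ < s.re} := by
  unfold Ftilde
  exact differentiableOn_id.add
    ((differentiableOn_id.mul (differentiableOn_id.sub (differentiableOn_const _))).mul
      (differentiableOn_mellin_errPsi hψ))

/-- **`F̃(s) = (s − 1) φ(s)` for `Re s > 1`.** [cite: Hilberdink2005, §1] -/
theorem Ftilde_eq_of_one_lt {B C θ : ℝ} (hB : ∀ x : ℝ, 1 ≤ x → (P.intCount x : ℝ) ≤ B * x) (hθ : θ ≤ 1)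
    (hψ : ∀ x : ℝ, 1 ≤ x → |P.chebyshevPsi x - x| ≤ C * x ^ θ) {s : ℂ} (hs : 1 < s.re) :
    Ftilde P s = (s - 1) * vonMangoldtSeries P s := by
  unfold Ftilde
  have hs1 : s - 1 ≠ 0 := by
    intro h0; have := congrArg Complex.re h0; simp at this; linarith
  have h := mul_mellin_errPsi_eq hB hθ hψ hs
  calc s + s * (s - 1) * mellin (errPsi P) (-s)
      = s + (s - 1) * (s * mellin (errPsi P) (-s)) := by ring
    _ = s + (s - 1) * (vonMangoldtSeries P s - s / (s - 1)) := by rw [h]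
    _ = (s - 1) * vonMangoldtSeries P s := by field_simp; ring

/-! ### The Euler logarithm and its derivative -/

variable (P)

/-- The Euler logarithm `L(s) = ∑_j log((1 − λ_j^{−s})⁻¹)` (so that `ζ_P(s) = exp(L(s))` for
`Re s > 1`: tree, `BeurlingPrimes.zeta_eq_exp_tsum`). [cite: Hilberdink2005, §1] -/
def eulerLog (s : ℂ) : ℂ := ∑' j, Complex.log ((1 - ((P.prime j : ℝ) : ℂ) ^ (-s))⁻¹)

/-- The `j`-th Euler factor logarithm. [folklore] -/
def eulerLogTerm (j : ℕ) (s : ℂ) : ℂ := Complex.log ((1 - ((P.prime j : ℝ) : ℂ) ^ (-s))⁻¹)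

/-- `ζ_P(s) = exp(L(s))` for `Re s > 1` (when `N_P(x) ≤ Bx`). [cite: Hilberdink2005, §1] -/
theorem zeta_eq_exp_eulerLog {B : ℝ} (hB : ∀ x : ℝ, 1 ≤ x → (P.intCount x : ℝ) ≤ B * x)
    {s : ℂ} (hs : 1 < s.re) : P.zeta s = Complex.exp (eulerLog P s) :=
  P.zeta_eq_exp_tsum (by linarith) (summable_prime_rpow P hB hs)

variable {P}

/-- `‖λ_j^{−s}‖ = λ_j^{−Re s} ≤ λ₀^{−σ₀}` for `Re s ≥ σ₀`. [folklore] -/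
theorem norm_prime_cpow_le {σ₀ : ℝ} {s : ℂ} (hs : σ₀ ≤ s.re) (j : ℕ) :
    ‖((P.prime j : ℝ) : ℂ) ^ (-s)‖ ≤ P.prime j ^ (-σ₀) := by
  rw [norm_cpow_eq_rpow_re_of_pos (P.prime_pos j), neg_re]
  exact Real.rpow_le_rpow_of_exponent_le (P.one_lt_prime j).le (by linarith)

/-- `λ_j^{−σ₀} ≤ λ₀^{−σ₀} < 1` for `σ₀ > 0`. [folklore] -/
theorem prime_rpow_le_q₀ {σ₀ : ℝ} (hσ₀ : 0 < σ₀) (j : ℕ) :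
    P.prime j ^ (-σ₀) ≤ P.prime 0 ^ (-σ₀) ∧ P.prime 0 ^ (-σ₀) < 1 :=
  ⟨Real.rpow_le_rpow_of_nonpos (P.prime_pos 0) (P.mono (Nat.zero_le j)) (by linarith),
    Real.rpow_lt_one_of_one_lt_of_neg P.one_lt (by linarith)⟩

/-- `1 − λ_j^{−s}` has positive real part (so it and its inverse lie in the slit plane) for `Re s > 0`.
[folklore] -/
theorem re_one_sub_prime_cpow_pos {s : ℂ} (hs : 0 < s.re) (j : ℕ) :
    0 < (1 - ((P.prime j : ℝ) : ℂ) ^ (-s)).re := by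
  have h1 : ‖((P.prime j : ℝ) : ℂ) ^ (-s)‖ < 1 := by
    rw [norm_cpow_eq_rpow_re_of_pos (P.prime_pos j), neg_re]
    exact Real.rpow_lt_one_of_one_lt_of_neg (P.one_lt_prime j) (by linarith)
  have := (abs_re_le_norm (((P.prime j : ℝ) : ℂ) ^ (-s))).trans_lt h1
  rw [sub_re, one_re]
  linarith [(abs_lt.mp this).2]

/-- **Termwise bound**: `‖log((1 − λ_j^{−s})⁻¹)‖ ≤ K(σ₀) λ_j^{−σ₀}` for `Re s ≥ σ₀ > 0`, with
`K(σ₀) = 1 + (1 − λ₀^{−σ₀})⁻¹/2` (from Mathlib's `‖log(1−z)⁻¹ − z‖ ≤ ‖z‖²(1−‖z‖)⁻¹/2`). [folklore] -/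
theorem norm_eulerLogTerm_le {σ₀ : ℝ} (hσ₀ : 0 < σ₀) {s : ℂ} (hs : σ₀ ≤ s.re) (j : ℕ) :
    ‖eulerLogTerm P j s‖ ≤ (1 + (1 - P.prime 0 ^ (-σ₀))⁻¹ / 2) * P.prime j ^ (-σ₀) := by
  obtain ⟨hq, hq₀⟩ := prime_rpow_le_q₀ (P := P) hσ₀ j
  set z : ℂ := ((P.prime j : ℝ) : ℂ) ^ (-s) with hz
  have hz1 : ‖z‖ ≤ P.prime j ^ (-σ₀) := norm_prime_cpow_le hs j
  have hzlt : ‖z‖ < 1 := (hz1.trans hq).trans_lt hq₀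
  have hmain := Complex.norm_log_one_sub_inv_sub_self_le hzlt
  have h0 : 0 ≤ P.prime j ^ (-σ₀) := Real.rpow_nonneg (P.prime_pos j).le _
  have hinv : (1 - ‖z‖)⁻¹ ≤ (1 - P.prime 0 ^ (-σ₀))⁻¹ :=
    inv_anti₀ (by linarith) (by linarith [hz1.trans hq])
  unfold eulerLogTerm
  rw [← hz]
  have hz2 : ‖z‖ ^ 2 ≤ P.prime j ^ (-σ₀) := by
    calc ‖z‖ ^ 2 = ‖z‖ * ‖z‖ := sq _
      _ ≤ P.prime j ^ (-σ₀) * 1 := mul_le_mul hz1 hzlt.le (norm_nonneg _) h0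
      _ = P.prime j ^ (-σ₀) := mul_one _
  have hA : ‖z‖ ^ 2 * (1 - ‖z‖)⁻¹ ≤ P.prime j ^ (-σ₀) * (1 - P.prime 0 ^ (-σ₀))⁻¹ :=
    mul_le_mul hz2 hinv (inv_nonneg.mpr (by linarith)) h0
  calc ‖Complex.log (1 - z)⁻¹‖ = ‖(Complex.log (1 - z)⁻¹ - z) + z‖ := by rw [sub_add_cancel]
    _ ≤ ‖Complex.log (1 - z)⁻¹ - z‖ + ‖z‖ := norm_add_le _ _
    _ ≤ ‖z‖ ^ 2 * (1 - ‖z‖)⁻¹ / 2 + ‖z‖ := by linarith [hmain]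
    _ ≤ P.prime j ^ (-σ₀) * (1 - P.prime 0 ^ (-σ₀))⁻¹ / 2 + P.prime j ^ (-σ₀) := by linarith [hA, hz1]
    _ = (1 + (1 - P.prime 0 ^ (-σ₀))⁻¹ / 2) * P.prime j ^ (-σ₀) := by ring

/-- **`‖L(s)‖ ≤ K(σ₀) ∑_j λ_j^{−σ₀}`** for `Re s ≥ σ₀ > 1` (when `N_P(x) ≤ Bx`). [folklore] -/
theorem norm_eulerLog_le {B : ℝ} (hB : ∀ x : ℝ, 1 ≤ x → (P.intCount x : ℝ) ≤ B * x)
    {σ₀ : ℝ} (hσ₀ : 1 < σ₀) {s : ℂ} (hs : σ₀ ≤ s.re) :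
    ‖eulerLog P s‖ ≤ (1 + (1 - P.prime 0 ^ (-σ₀))⁻¹ / 2) * ∑' j, P.prime j ^ (-σ₀) := by
  have hsum := summable_prime_rpow P hB hσ₀
  rw [← tsum_mul_left]
  refine tsum_of_norm_bounded (hsum.mul_left _).hasSum fun j ↦ ?_
  exact norm_eulerLogTerm_le (by linarith) hs j

/-- The derivative of `s ↦ λ^{−s}`: `−log λ · λ^{−s}` (`λ > 0`). [folklore] -/
theorem hasDerivAt_prime_cpow (j : ℕ) (s : ℂ) :
    HasDerivAt (fun s ↦ ((P.prime j : ℝ) : ℂ) ^ (-s))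
      (-(Real.log (P.prime j) : ℂ) * ((P.prime j : ℝ) : ℂ) ^ (-s)) s := by
  have hp : ((P.prime j : ℝ) : ℂ) ≠ 0 := ofReal_ne_zero.mpr (P.prime_pos j).ne'
  have h := (hasDerivAt_neg s).const_cpow (c := ((P.prime j : ℝ) : ℂ)) (Or.inl hp)
  convert h using 1
  rw [Complex.ofReal_log (P.prime_pos j).le]
  ring

/-- The derivative of the `j`-th Euler logarithm: `−log λ_j · λ_j^{−s}/(1 − λ_j^{−s})` (`Re s > 0`).
[folklore] -/
theorem hasDerivAt_eulerLogTerm {s : ℂ} (hs : 0 < s.re) (j : ℕ) :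
    HasDerivAt (eulerLogTerm P j)
      (-(Real.log (P.prime j) : ℂ) * ((P.prime j : ℝ) : ℂ) ^ (-s) / (1 - ((P.prime j : ℝ) : ℂ) ^ (-s))) s := by
  have hre := re_one_sub_prime_cpow_pos (P := P) hs j
  have hne : (1 - ((P.prime j : ℝ) : ℂ) ^ (-s)) ≠ 0 := fun h ↦ by rw [h] at hre; simp at hre
  -- `h(s) = (1 − λ^{−s})⁻¹`
  have h1 : HasDerivAt (fun s ↦ 1 - ((P.prime j : ℝ) : ℂ) ^ (-s))
      (-(-(Real.log (P.prime j) : ℂ) * ((P.prime j : ℝ) : ℂ) ^ (-s))) s := by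
    simpa using (hasDerivAt_prime_cpow (P := P) j s).const_sub 1
  have h2 := h1.inv hne
  have hslit : (1 - ((P.prime j : ℝ) : ℂ) ^ (-s))⁻¹ ∈ slitPlane := by
    refine Complex.mem_slitPlane_iff.mpr (Or.inl ?_)
    rw [inv_re]
    exact div_pos hre (Complex.normSq_pos.mpr hne)
  have h3 := h2.clog hslit
  have h4 : HasDerivAt (eulerLogTerm P j)
      (-(-(-(Real.log (P.prime j) : ℂ) * ((P.prime j : ℝ) : ℂ) ^ (-s))) /
        (1 - ((P.prime j : ℝ) : ℂ) ^ (-s)) ^ 2 / (1 - ((P.prime j : ℝ) : ℂ) ^ (-s))⁻¹) s := h3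
  convert h4 using 1
  field_simp

/-- The derivative term: its norm is `≤ K'(σ₀) log λ_j λ_j^{−σ₀} ≤ …`; we only need the crude bound
`‖deriv‖ ≤ log λ_j λ_j^{−σ₀}/(1 − λ₀^{−σ₀})` for `Re s ≥ σ₀`. [folklore] -/
theorem norm_deriv_eulerLogTerm_le {σ₀ : ℝ} (hσ₀ : 0 < σ₀) {s : ℂ} (hs : σ₀ ≤ s.re) (j : ℕ) :
    ‖-(Real.log (P.prime j) : ℂ) * ((P.prime j : ℝ) : ℂ) ^ (-s) / (1 - ((P.prime j : ℝ) : ℂ) ^ (-s))‖ ≤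
      Real.log (P.prime j) * P.prime j ^ (-σ₀) / (1 - P.prime 0 ^ (-σ₀)) := by
  obtain ⟨hq, hq₀⟩ := prime_rpow_le_q₀ (P := P) hσ₀ j
  have hz1 : ‖((P.prime j : ℝ) : ℂ) ^ (-s)‖ ≤ P.prime j ^ (-σ₀) := norm_prime_cpow_le hs j
  have hden : 1 - P.prime 0 ^ (-σ₀) ≤ ‖1 - ((P.prime j : ℝ) : ℂ) ^ (-s)‖ := by
    calc 1 - P.prime 0 ^ (-σ₀) ≤ 1 - ‖((P.prime j : ℝ) : ℂ) ^ (-s)‖ := by linarith [hz1.trans hq]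
      _ = ‖(1 : ℂ)‖ - ‖((P.prime j : ℝ) : ℂ) ^ (-s)‖ := by rw [norm_one]
      _ ≤ ‖1 - ((P.prime j : ℝ) : ℂ) ^ (-s)‖ := norm_sub_norm_le _ _
  have hlog : 0 ≤ Real.log (P.prime j) := (Real.log_pos (P.one_lt_prime j)).le
  rw [norm_div, norm_mul, norm_neg, Complex.norm_real, Real.norm_eq_abs, abs_of_nonneg hlog]
  have hd0 : 0 < 1 - P.prime 0 ^ (-σ₀) := by linarith
  rw [div_le_div_iff₀ (hd0.trans_le hden) hd0]
  have hq0 : 0 ≤ P.prime j ^ (-σ₀) := Real.rpow_nonneg (P.prime_pos j).le _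
  have hlq : 0 ≤ Real.log (P.prime j) * P.prime j ^ (-σ₀) := mul_nonneg hlog hq0
  calc Real.log (P.prime j) * ‖((P.prime j : ℝ) : ℂ) ^ (-s)‖ * (1 - P.prime 0 ^ (-σ₀))
      ≤ Real.log (P.prime j) * P.prime j ^ (-σ₀) * (1 - P.prime 0 ^ (-σ₀)) := by gcongr
    _ ≤ Real.log (P.prime j) * P.prime j ^ (-σ₀) * ‖1 - ((P.prime j : ℝ) : ℂ) ^ (-s)‖ := by gcongr

/-- `∑_j log λ_j · λ_j^{−σ₀} < ∞` for `σ₀ > 1` (the `m = 0` slice of `summable_primePow_rpow`). [folklore] -/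
theorem summable_log_mul_prime_rpow {B : ℝ} (hB : ∀ x : ℝ, 1 ≤ x → (P.intCount x : ℝ) ≤ B * x)
    {σ₀ : ℝ} (hσ₀ : 1 < σ₀) : Summable fun j ↦ Real.log (P.prime j) * P.prime j ^ (-σ₀) := by
  have h := (summable_primePow_rpow P hB hσ₀).comp_injective
    (show Function.Injective fun j : ℕ ↦ (j, 0) from fun a b hab ↦ by simpa using hab)
  refine h.congr fun j ↦ ?_
  simp

/-- **`L` is holomorphic on `Re s > 1` and `L'(s) = −φ(s)`**: termwise differentiation
(Mathlib `Complex.hasSum_deriv_of_summable_norm` on `Re s > σ₀` for each `σ₀ > 1`) and the geometric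
series `λ^{−s}/(1 − λ^{−s}) = ∑_{m ≥ 0} λ^{−(m+1)s}`. [cite: Hilberdink2005, §1] -/
theorem hasDerivAt_eulerLog {B : ℝ} (hB : ∀ x : ℝ, 1 ≤ x → (P.intCount x : ℝ) ≤ B * x)
    {s : ℂ} (hs : 1 < s.re) :
    DifferentiableAt ℂ (eulerLog P) s ∧ deriv (eulerLog P) s = -vonMangoldtSeries P s := by
  -- work on `U = {Re > σ₀}` with `1 < σ₀ < Re s`
  set σ₀ : ℝ := (1 + s.re) / 2 with hσ₀def
  have hσ₀ : 1 < σ₀ := by rw [hσ₀def]; linarith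
  have hσ₀s : σ₀ < s.re := by rw [hσ₀def]; linarith
  have hσ₀0 : 0 < σ₀ := by linarith
  set U : Set ℂ := {w : ℂ | σ₀ < w.re} with hU
  have hUo : IsOpen U := isOpen_lt continuous_const Complex.continuous_re
  have hsU : s ∈ U := hσ₀s
  have hq₀ : P.prime 0 ^ (-σ₀) < 1 := (prime_rpow_le_q₀ (P := P) hσ₀0 0).2
  -- uniform summable bound for the terms
  have hF_le : ∀ (j : ℕ) (w : ℂ), w ∈ U → ‖eulerLogTerm P j w‖ ≤
      (1 + (1 - P.prime 0 ^ (-σ₀))⁻¹ / 2) * P.prime j ^ (-σ₀) :=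
    fun j w hw ↦ norm_eulerLogTerm_le hσ₀0 (le_of_lt hw) j
  have hu : Summable fun j ↦ (1 + (1 - P.prime 0 ^ (-σ₀))⁻¹ / 2) * P.prime j ^ (-σ₀) :=
    (summable_prime_rpow P hB hσ₀).mul_left _
  have hf : ∀ j, DifferentiableOn ℂ (eulerLogTerm P j) U := fun j w hw ↦
    (hasDerivAt_eulerLogTerm (hσ₀0.trans hw) j).differentiableAt.differentiableWithinAt
  have hdiff : DifferentiableOn ℂ (fun w ↦ ∑' j, eulerLogTerm P j w) U :=
    Complex.differentiableOn_tsum_of_summable_norm hu hf hUo hF_le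
  have hderiv := Complex.hasSum_deriv_of_summable_norm hu hf hUo hF_le hsU
  have hfun : eulerLog P = fun w ↦ ∑' j, eulerLogTerm P j w := rfl
  refine ⟨?_, ?_⟩
  · rw [hfun]; exact hdiff.differentiableAt (hUo.mem_nhds hsU)
  · rw [hfun]
    refine (hderiv.unique ?_)
    -- `∑_j deriv (term j) s = −φ(s)`: compute each derivative and sum the geometric series in `m`
    have hs0 : 0 < s.re := by linarith
    have hderj : ∀ j, deriv (eulerLogTerm P j) s =
        -(Real.log (P.prime j) : ℂ) * ((P.prime j : ℝ) : ℂ) ^ (-s) / (1 - ((P.prime j : ℝ) : ℂ) ^ (-s)) :=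
      fun j ↦ (hasDerivAt_eulerLogTerm hs0 j).deriv
    simp_rw [hderj]
    -- the double series
    have hsumm := (summable_norm_vonMangoldt_term P hB hs)
    have hprod := hsumm.of_norm
    have hgeo : ∀ j, HasSum (fun m : ℕ ↦ (Real.log (P.prime j) : ℂ) * ((P.prime j ^ (m + 1) : ℝ) : ℂ) ^ (-s))
        ((Real.log (P.prime j) : ℂ) * ((P.prime j : ℝ) : ℂ) ^ (-s) / (1 - ((P.prime j : ℝ) : ℂ) ^ (-s))) := by
      intro j
      set w : ℂ := ((P.prime j : ℝ) : ℂ) ^ (-s) with hw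
      have hw1 : ‖w‖ < 1 := by
        rw [hw, norm_cpow_eq_rpow_re_of_pos (P.prime_pos j), neg_re]
        exact Real.rpow_lt_one_of_one_lt_of_neg (P.one_lt_prime j) (by linarith)
      have hlam : (0 : ℝ) < P.prime j := P.prime_pos j
      have hterm : ∀ m : ℕ, ((P.prime j ^ (m + 1) : ℝ) : ℂ) ^ (-s) = w * w ^ m := by
        intro m
        rw [← pow_succ', hw, cpow_def_of_ne_zero (ofReal_ne_zero.mpr (pow_pos hlam _).ne'),
          cpow_def_of_ne_zero (ofReal_ne_zero.mpr hlam.ne'), ← Complex.exp_nat_mul,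
          ← Complex.ofReal_log (pow_pos hlam _).le, ← Complex.ofReal_log hlam.le, Real.log_pow]
        congr 1
        push_cast
        ring
      have hne : (1 - w) ≠ 0 := by
        intro h; have := re_one_sub_prime_cpow_pos (P := P) hs0 j; rw [← hw, h] at this; simp at this
      have hg := (hasSum_geometric_of_norm_lt_one hw1).mul_left ((Real.log (P.prime j) : ℂ) * w)
      have hfun : (fun m : ℕ ↦ (Real.log (P.prime j) : ℂ) * ((P.prime j ^ (m + 1) : ℝ) : ℂ) ^ (-s)) =
          fun m ↦ (Real.log (P.prime j) : ℂ) * w * w ^ m := by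
        funext m; rw [hterm m]; ring
      have hval : (Real.log (P.prime j) : ℂ) * w / (1 - w) = (Real.log (P.prime j) : ℂ) * w * (1 - w)⁻¹ :=
        div_eq_mul_inv _ _
      rw [hfun, hval]
      exact hg
    have h2 := hprod.tsum_prod' (fun j ↦ (hgeo j).summable)
    -- `∑' (j,m) = ∑' j ∑' m`
    have hneg : -vonMangoldtSeries P s = ∑' j, -((Real.log (P.prime j) : ℂ) * ((P.prime j : ℝ) : ℂ) ^ (-s) /
        (1 - ((P.prime j : ℝ) : ℂ) ^ (-s))) := by
      rw [tsum_neg, vonMangoldtSeries, h2]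
      congr 1
      exact tsum_congr fun j ↦ (hgeo j).tsum_eq
    rw [hneg]
    refine (Summable.hasSum ?_).congr_fun fun j ↦ by ring
    refine Summable.neg (Summable.of_norm ?_)
    refine Summable.of_nonneg_of_le (fun j ↦ norm_nonneg _) (fun j ↦ ?_)
      ((summable_log_mul_prime_rpow hB hσ₀).div_const (1 - P.prime 0 ^ (-σ₀)))
    have := norm_deriv_eulerLogTerm_le (P := P) hσ₀0 hσ₀s.le j
    rw [norm_div, norm_mul, norm_neg] at this
    rw [norm_div, norm_mul]
    exact this

end Hilberdink

end Literature.NumberTheory.BeurlingPrimes
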